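import Summits.ResolutionOfSingularities.ResolutionOfSingularities.Theorems.FrobeniusClosingPatchingRelPerfectMonomialScalingStableIdeal
import Mathlib.RingTheory.MvPolynomial.Ideal
import Mathlib.RingTheory.Localization.AtPrime.Basic
import Mathlib.RingTheory.Localization.Ideal
import HarnessLib

/-!
# Crux `PatchingRelPerfect` (stmt-ResolutionOfSingularities-16161), chain w52 — TargetsF3 (m)
# «M2-strong», COMBINATORIAL HALF, Route K step K7: CHART ALGEBRA in the polynomial ring — coordinate
# primes, the order of a monomial ideal at a coordinate prime, and «scaling-stable + prime at the
# origin ⇒ a coordinate ideal»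

[OURS · L1 W5.2 · design memo v3 (`L/res-type-075/M2STRONG-COMBINATORIAL-HALF.md`); fact-free;
nothing here is a statement of the manuscript under review]

Every chart of Route K's blow-up tower over the toric model `𝔸^{B}_ℚ` of a simplex state is the
polynomial ring `K[x_σ]` itself (file K6 `routeKTarget_of_simplex`; tree `CoordinateBlowupChart.lean`).
This file is the commutative algebra read in such a chart:

* `coordIdeal S = (x_i : i ∈ S)` and `sdeg S γ = Σ_{i∈S} γ_i`; **`mem_coordIdeal_pow_iff`** — `f ∈
  (x_S)^k` iff every exponent in the support of `f` has `S`-degree `≥ k`; `coordIdeal_isPrime`.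
* **`map_span_monomial_le_pow_iff`** — at the local ring of the coordinate prime `(x_S)` (any
  `IsLocalization.AtPrime`), the monomial ideal `(x^β : β ∈ A)` lies in `𝔪^k` iff every `β ∈ A` has
  `S`-degree `≥ k`: the ORDER of a monomial ideal along the stratum `V(x_S)` is the least `S`-degree
  (the read-out of Kollár's `cosupp (I, m)` at the generic point of a stratum).
* **`eq_coordIdeal_of_scaling_stable_of_isPrime`** — an ideal `I ≠ ⊤` of `K[x_σ]` (`K` infinite)
  which is stable under all coordinate scalings `x_i ↦ c x_i` and whose extension to the local ring
  AT THE ORIGIN is prime is the coordinate ideal `(x_i : x_i ∈ I)`.  (Stability makes every term of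
  every element lie in `I` — file K3(b) `monomial_mem_of_scaling_stable`; primality at the origin
  splits a monomial `x_i · x^{γ - e_i} ∈ I` and a degree induction finds a variable of `I` dividing
  it.)  This is how a torus-stable REGULAR centre of the functorial resolution is read, chart by
  chart, as ONE coordinate stratum.
-/

-- `Summit.<Summit>.<Sub>.Theorems` with `Sub = Summit` (single-conjunct summit, D-0017)
set_option linter.dupNamespace false

noncomputable section

namespace Summit.ResolutionOfSingularities.ResolutionOfSingularities.Theorems

namespace PolyhedraGame

namespace RouteK

open MvPolynomial Finset

variable {σ : Type*} {K : Type*} [Field K]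

/-! ## Coordinate ideals and the `S`-degree -/

/-- [OURS] The coordinate ideal `(x_i : i ∈ S)` of `K[x_σ]` (the ideal of the stratum `V(x_S)`). -/
def coordIdeal (S : Finset σ) : Ideal (MvPolynomial σ K) := Ideal.span (X '' (S : Set σ))

/-- [OURS] The `S`-degree `Σ_{i ∈ S} γ_i` of an exponent vector (the order of `x^γ` along `V(x_S)`). -/
def sdeg (S : Finset σ) (γ : σ →₀ ℕ) : ℕ := ∑ i ∈ S, γ i

/-- [OURS] The `S`-degree is additive. -/
theorem sdeg_add (S : Finset σ) (γ δ : σ →₀ ℕ) : sdeg S (γ + δ) = sdeg S γ + sdeg S δ := by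
  simp [sdeg, Finset.sum_add_distrib]

/-- [OURS] Positive `S`-degree ⟺ some coordinate in `S` is non-zero. -/
theorem one_le_sdeg_iff (S : Finset σ) (γ : σ →₀ ℕ) : 1 ≤ sdeg S γ ↔ ∃ i ∈ S, γ i ≠ 0 := by
  rw [Nat.one_le_iff_ne_zero, sdeg, Ne, Finset.sum_eq_zero_iff]
  simp

/-- [OURS] A variable of `S` lies in the coordinate ideal. -/
theorem X_mem_coordIdeal {S : Finset σ} {i : σ} (hi : i ∈ S) : (X i : MvPolynomial σ K) ∈ coordIdeal S :=
  Ideal.subset_span ⟨i, Finset.mem_coe.mpr hi, rfl⟩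

/-- [OURS] Membership in the coordinate ideal: every exponent of the support involves `S`. -/
theorem mem_coordIdeal_iff (S : Finset σ) (f : MvPolynomial σ K) :
    f ∈ coordIdeal S ↔ ∀ γ ∈ f.support, 1 ≤ sdeg S γ := by
  unfold coordIdeal
  rw [mem_ideal_span_X_image]
  refine forall₂_congr fun γ _ => ?_
  rw [one_le_sdeg_iff]
  simp only [Finset.mem_coe]

/-- [OURS] **Membership in a power of the coordinate ideal**: `f ∈ (x_S)^k` iff every exponent in the
support of `f` has `S`-degree `≥ k`. -/
theorem mem_coordIdeal_pow_iff [DecidableEq σ] (S : Finset σ) (k : ℕ) (f : MvPolynomial σ K) :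
    f ∈ coordIdeal S ^ k ↔ ∀ γ ∈ f.support, k ≤ sdeg S γ := by
  constructor
  · -- by induction on `k`, through `P^(k+1) = P * P^k`
    induction k generalizing f with
    | zero => intro _ γ _; exact Nat.zero_le _
    | succ k ih =>
      intro hf
      rw [pow_succ'] at hf
      refine Submodule.mul_induction_on hf ?_ ?_
      · intro g hg h hh γ hγ
        have hsub := support_mul g h hγ
        obtain ⟨γ₁, hγ₁, γ₂, hγ₂, rfl⟩ := Finset.mem_add.mp hsub
        rw [sdeg_add]
        have h1 := (mem_coordIdeal_iff S g).mp hg γ₁ hγ₁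
        have h2 := ih h hh γ₂ hγ₂
        omega
      · intro g h hg hh γ hγ
        rcases Finset.mem_union.mp (support_add hγ) with hγ' | hγ'
        · exact hg γ hγ'
        · exact hh γ hγ'
  · intro h
    rw [f.as_sum]
    refine Ideal.sum_mem _ fun γ hγ => ?_
    -- the `S`-part `δ = Σ_{i∈S} γ_i e_i` of `γ`: `x^δ ∈ P^{sdeg}` divides `x^γ`
    set δ : σ →₀ ℕ := ∑ i ∈ S, Finsupp.single i (γ i) with hδ
    have hδapp : ∀ j, δ j = if j ∈ S then γ j else 0 := fun j => by
      rw [hδ, Finsupp.finsetSum_apply]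
      simp only [Finsupp.single_apply]
      split_ifs with hj
      · rw [Finset.sum_eq_single_of_mem j hj (fun i _ hij => if_neg hij), if_pos rfl]
      · exact Finset.sum_eq_zero fun i hi => if_neg (fun h : i = j => hj (h ▸ hi))
    have hδmem : monomial δ (1 : K) ∈ coordIdeal S ^ k := by
      have hprod : monomial δ (1 : K) = ∏ i ∈ S, (X i : MvPolynomial σ K) ^ γ i := by
        rw [hδ, monomial_sum_one]
        exact Finset.prod_congr rfl fun i _ => (X_pow_eq_monomial).symm
      have hmem : (∏ i ∈ S, (X i : MvPolynomial σ K) ^ γ i) ∈ ∏ i ∈ S, coordIdeal S ^ γ i :=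
        Ideal.prod_mem_prod fun i hi => Ideal.pow_mem_pow (X_mem_coordIdeal hi) _
      rw [Finset.prod_pow_eq_pow_sum] at hmem
      rw [hprod]
      exact Ideal.pow_le_pow_right (h γ hγ) hmem
    have hdvd : monomial δ (1 : K) ∣ monomial γ (coeff γ f) := by
      rw [monomial_dvd_monomial]
      refine ⟨Or.inr fun j => ?_, one_dvd _⟩
      rw [hδapp]
      split_ifs <;> omega
    obtain ⟨q, hq⟩ := hdvd
    rw [hq]
    exact Ideal.mul_mem_right _ _ hδmem

/-- [OURS] The substitution killing the variables of `S`. -/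
noncomputable def killVars [DecidableEq σ] (S : Finset σ) : MvPolynomial σ K →ₐ[K] MvPolynomial σ K :=
  aeval fun i => if i ∈ S then 0 else X i

/-- [OURS] `f - killVars S f ∈ (x_S)`. -/
theorem sub_killVars_mem [DecidableEq σ] (S : Finset σ) (f : MvPolynomial σ K) :
    f - killVars S f ∈ (coordIdeal S : Ideal (MvPolynomial σ K)) := by
  induction f using MvPolynomial.induction_on with
  | C c =>
    rw [show killVars S (C c) = C c from (killVars S).commutes c, sub_self]
    exact Ideal.zero_mem _
  | add f g hf hg =>
    have : f + g - killVars S (f + g) = (f - killVars S f) + (g - killVars S g) := by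
      rw [map_add]; ring
    rw [this]; exact Ideal.add_mem _ hf hg
  | mul_X f i hf =>
    have : f * X i - killVars S (f * X i) =
        (f - killVars S f) * X i + killVars S f * (X i - killVars S (X i)) := by
      rw [map_mul]; ring
    rw [this]
    refine Ideal.add_mem _ (Ideal.mul_mem_right _ _ hf) (Ideal.mul_mem_left _ _ ?_)
    by_cases hi : i ∈ S
    · simp [killVars, hi, X_mem_coordIdeal hi]
    · simp [killVars, hi]

/-- [OURS] The coordinate ideal is the kernel of `killVars S`. -/
theorem ker_killVars [DecidableEq σ] (S : Finset σ) :
    RingHom.ker (killVars (K := K) S).toRingHom = coordIdeal S := by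
  apply le_antisymm
  · intro f hf
    rw [RingHom.mem_ker] at hf
    have h := sub_killVars_mem (K := K) S f
    have hf' : killVars S f = 0 := hf
    rwa [hf', sub_zero] at h
  · unfold coordIdeal
    rw [Ideal.span_le]
    rintro _ ⟨i, hi, rfl⟩
    rw [SetLike.mem_coe, RingHom.mem_ker]
    simp [killVars, Finset.mem_coe.mp hi]

/-- [OURS] **Coordinate ideals are prime.** -/
theorem coordIdeal_isPrime [DecidableEq σ] (S : Finset σ) : (coordIdeal (K := K) S).IsPrime := by
  rw [← ker_killVars]
  exact RingHom.ker_isPrime _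

/-- [OURS] An element outside `(x_S)` has a term not involving `S`. -/
theorem exists_sdeg_eq_zero_of_not_mem {S : Finset σ} {f : MvPolynomial σ K} (hf : f ∉ coordIdeal S) :
    ∃ γ ∈ f.support, sdeg S γ = 0 := by
  rw [mem_coordIdeal_iff] at hf
  push Not at hf
  obtain ⟨γ, hγ, h⟩ := hf
  exact ⟨γ, hγ, by omega⟩

/-! ## The order of a monomial ideal at a coordinate prime -/

/-- [OURS · Route K, K7] **The order of a monomial ideal along the stratum `V(x_S)`**: at any
localization of `K[x_σ]` at the prime `(x_S)`, the ideal `(x^β : β ∈ A)` lies in `𝔪^k` iff every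
`β ∈ A` has `S`-degree `≥ k`. -/
theorem map_span_monomial_le_pow_iff [DecidableEq σ] (S : Finset σ) (A : Set (σ →₀ ℕ))
    (Rₚ : Type*) [CommRing Rₚ] [Algebra (MvPolynomial σ K) Rₚ] [IsLocalRing Rₚ]
    [(coordIdeal (K := K) S).IsPrime] [IsLocalization.AtPrime Rₚ (coordIdeal (K := K) S)] (k : ℕ) :
    (Ideal.span ((fun β => monomial β (1 : K)) '' A)).map (algebraMap _ Rₚ) ≤
        IsLocalRing.maximalIdeal Rₚ ^ k ↔ ∀ β ∈ A, k ≤ sdeg S β := by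
  have hmax : IsLocalRing.maximalIdeal Rₚ ^ k = (coordIdeal (K := K) S ^ k).map (algebraMap _ Rₚ) := by
    rw [Ideal.map_pow, IsLocalization.AtPrime.map_eq_maximalIdeal]
  rw [hmax, Ideal.map_span, Ideal.span_le]
  constructor
  · intro h β hβ
    have hmem : algebraMap _ Rₚ (monomial β (1 : K)) ∈ (coordIdeal (K := K) S ^ k).map (algebraMap _ Rₚ) :=
      h ⟨_, ⟨β, hβ, rfl⟩, rfl⟩
    obtain ⟨s, hs, hsβ⟩ :=
      (IsLocalization.algebraMap_mem_map_algebraMap_iff (coordIdeal (K := K) S).primeCompl Rₚ _ _).mp hmem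
    -- a term of `s` off `S` survives in `s * x^β`
    obtain ⟨γ, hγ, hγ0⟩ := exists_sdeg_eq_zero_of_not_mem (show s ∉ coordIdeal S from hs)
    have hsupp : γ + β ∈ (s * monomial β (1 : K)).support := by
      rw [mem_support_iff, coeff_mul_monomial, mul_one]
      exact mem_support_iff.mp hγ
    have := (mem_coordIdeal_pow_iff S k _).mp hsβ (γ + β) hsupp
    rw [sdeg_add, hγ0, zero_add] at this
    exact this
  · rintro h _ ⟨_, ⟨β, hβ, rfl⟩, rfl⟩
    refine Ideal.mem_map_of_mem _ ((mem_coordIdeal_pow_iff S k _).mpr fun γ hγ => ?_)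
    classical
    rw [support_monomial, if_neg one_ne_zero, Finset.mem_singleton] at hγ
    rw [hγ]
    exact h β hβ

/-! ## Scaling-stable ideals which are prime at the origin are coordinate ideals -/

/-- [OURS] The ideal of the origin `(x_i : i ∈ σ)` is the coordinate ideal of all variables. -/
theorem coordIdeal_univ [Fintype σ] : coordIdeal (K := K) (Finset.univ : Finset σ) = idealOfVars σ K := by
  simp [coordIdeal, idealOfVars, Set.image_univ]

/-- [OURS] An element outside the ideal of the origin has a non-zero constant term. -/
theorem coeff_zero_ne_zero_of_not_mem [Fintype σ] {f : MvPolynomial σ K} (hf : f ∉ idealOfVars σ K) :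
    coeff 0 f ≠ 0 := by
  rw [← coordIdeal_univ] at hf
  obtain ⟨γ, hγ, h0⟩ := exists_sdeg_eq_zero_of_not_mem hf
  have : γ = 0 := by
    ext i
    have := Finset.sum_eq_zero_iff.mp h0 i (Finset.mem_univ i)
    simpa using this
  subst this
  exact mem_support_iff.mp hγ

/-- [OURS] The ideal of the origin is prime (a coordinate ideal). -/
theorem idealOfVars_isPrime [DecidableEq σ] [Fintype σ] : (idealOfVars σ K).IsPrime := by
  rw [← coordIdeal_univ]; exact coordIdeal_isPrime _

section Stable

variable [DecidableEq σ] {I : Ideal (MvPolynomial σ K)}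
  {Rₘ : Type*} [CommRing Rₘ] [Algebra (MvPolynomial σ K) Rₘ]
  [(idealOfVars σ K).IsPrime] [IsLocalization.AtPrime Rₘ (idealOfVars σ K)]

omit [DecidableEq σ] in
/-- [OURS] If the extension of `I` to the local ring at the origin is prime, a product in `I` has a
factor multiplied into `I` by an element with non-zero constant term. -/
theorem exists_mul_mem_of_mul_mem (hprime : (I.map (algebraMap _ Rₘ)).IsPrime) {f g : MvPolynomial σ K}
    (h : f * g ∈ I) : (∃ s ∉ idealOfVars σ K, s * f ∈ I) ∨ ∃ s ∉ idealOfVars σ K, s * g ∈ I := by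
  have hfg : algebraMap _ Rₘ f * algebraMap _ Rₘ g ∈ I.map (algebraMap _ Rₘ) := by
    rw [← map_mul]; exact Ideal.mem_map_of_mem _ h
  rcases hprime.mem_or_mem hfg with hf | hg
  · obtain ⟨s, hs, hsf⟩ :=
      (IsLocalization.algebraMap_mem_map_algebraMap_iff (idealOfVars σ K).primeCompl Rₘ _ _).mp hf
    exact Or.inl ⟨s, hs, hsf⟩
  · obtain ⟨s, hs, hsg⟩ :=
      (IsLocalization.algebraMap_mem_map_algebraMap_iff (idealOfVars σ K).primeCompl Rₘ _ _).mp hg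
    exact Or.inr ⟨s, hs, hsg⟩

variable [Fintype σ] [Infinite K]
  (hI : ∀ (i : σ) (c : K), c ≠ 0 → ∀ f ∈ I, aeval (Function.update X i (C c * X i)) f ∈ I)

include hI

omit [(idealOfVars σ K).IsPrime] [IsLocalization.AtPrime Rₘ (idealOfVars σ K)] in
/-- [OURS] In a scaling-stable ideal, a monic monomial multiplied into `I` by an element with
non-zero constant term lies in `I`. -/
theorem monomial_mem_of_mul_mem {s : MvPolynomial σ K} (hs : s ∉ idealOfVars σ K)
    {δ : σ →₀ ℕ} (h : s * monomial δ 1 ∈ I) : monomial δ (1 : K) ∈ I := by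
  have hc : coeff 0 s ≠ 0 := coeff_zero_ne_zero_of_not_mem hs
  have hterm := monomial_mem_of_scaling_stable hI h δ
  rw [show coeff δ (s * monomial δ 1) = coeff 0 s by
    have := coeff_mul_monomial 0 δ (1 : K) s; rwa [zero_add, mul_one] at this] at hterm
  have := I.mul_mem_left (C (coeff 0 s)⁻¹) hterm
  rwa [C_mul_monomial, inv_mul_cancel₀ hc] at this

omit [(idealOfVars σ K).IsPrime] [IsLocalization.AtPrime Rₘ (idealOfVars σ K)] in
/-- [OURS] A scaling-stable proper ideal lies in the ideal of the origin. -/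
theorem le_idealOfVars_of_scaling_stable (hI' : I ≠ ⊤) : I ≤ idealOfVars σ K := by
  intro f hf
  by_contra h
  have hc : coeff 0 f ≠ 0 := coeff_zero_ne_zero_of_not_mem h
  have hterm := monomial_mem_of_scaling_stable hI hf 0
  apply hI'
  rw [Ideal.eq_top_iff_one]
  have := I.mul_mem_left (C (coeff 0 f)⁻¹) hterm
  rw [C_mul_monomial, inv_mul_cancel₀ hc, ← C_apply, C_1] at this
  exact this

/-- [OURS] Degree induction: a monic monomial of a scaling-stable proper ideal prime at the origin is
divisible by a VARIABLE of the ideal. -/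
theorem exists_X_mem_of_monomial_mem (hI' : I ≠ ⊤) (hprime : (I.map (algebraMap _ Rₘ)).IsPrime) :
    ∀ (n : ℕ) (γ : σ →₀ ℕ), γ.degree = n → monomial γ (1 : K) ∈ I → ∃ i ∈ γ.support, (X i : MvPolynomial σ K) ∈ I := by
  intro n
  induction n using Nat.strong_induction_on with
  | _ n ih =>
    intro γ hγn hγ
    by_cases h0 : γ = 0
    · subst h0
      exact absurd (Ideal.eq_top_iff_one _ |>.mpr (by simpa using hγ)) hI'
    obtain ⟨i, hi⟩ : γ.support.Nonempty := Finsupp.support_nonempty_iff.mpr h0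
    have hγi : 1 ≤ γ i := Nat.one_le_iff_ne_zero.mpr (Finsupp.mem_support_iff.mp hi)
    set γ' := γ - Finsupp.single i 1 with hγ'
    have hγeq : γ = Finsupp.single i 1 + γ' := by
      ext j
      simp only [hγ', Finsupp.coe_add, Pi.add_apply, Finsupp.coe_tsub, Pi.sub_apply,
        Finsupp.single_apply]
      split_ifs with h
      · subst h; omega
      · omega
    have hsplit : monomial γ (1 : K) = X i * monomial γ' 1 := by
      rw [X, monomial_mul, one_mul, ← hγeq]
    rw [hsplit] at hγ
    rcases exists_mul_mem_of_mul_mem hprime hγ with ⟨s, hs, hsX⟩ | ⟨s, hs, hsγ'⟩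
    · refine ⟨i, hi, ?_⟩
      have := monomial_mem_of_mul_mem hI (hs := hs) (δ := Finsupp.single i 1) (h := by simpa [X] using hsX)
      simpa [X] using this
    · have hmem : monomial γ' (1 : K) ∈ I := monomial_mem_of_mul_mem hI hs hsγ'
      have hdeg : γ'.degree < n := by
        have h1 : γ.degree = 1 + γ'.degree := by
          rw [hγeq, map_add, Finsupp.degree_single]
        omega
      obtain ⟨j, hj, hjI⟩ := ih _ hdeg γ' rfl hmem
      refine ⟨j, ?_, hjI⟩
      rw [Finsupp.mem_support_iff] at hj ⊢
      rw [hγeq, Finsupp.add_apply]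
      omega

/-- [OURS · Route K, K7] **A scaling-stable proper ideal of `K[x_σ]` (`K` infinite) whose extension to
the local ring at the origin is prime is the coordinate ideal of the variables it contains.** -/
theorem eq_coordIdeal_of_scaling_stable_of_isPrime (hI' : I ≠ ⊤)
    (hprime : (I.map (algebraMap _ Rₘ)).IsPrime) :
    ∃ S : Finset σ, I = coordIdeal S ∧ ∀ i, i ∈ S ↔ (X i : MvPolynomial σ K) ∈ I := by
  classical
  refine ⟨Finset.univ.filter fun i => (X i : MvPolynomial σ K) ∈ I, le_antisymm ?_ ?_, fun i => by simp⟩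
  · intro f hf
    rw [f.as_sum]
    refine Ideal.sum_mem _ fun γ hγ => ?_
    have hc : coeff γ f ≠ 0 := mem_support_iff.mp hγ
    have h1 : monomial γ (1 : K) ∈ I := by
      have := I.mul_mem_left (C (coeff γ f)⁻¹) (monomial_mem_of_scaling_stable hI hf γ)
      rwa [C_mul_monomial, inv_mul_cancel₀ hc] at this
    obtain ⟨i, hi, hiI⟩ := exists_X_mem_of_monomial_mem hI hI' hprime _ γ rfl h1
    rw [mem_coordIdeal_iff]
    intro γ₁ hγ₁
    rw [support_monomial, if_neg hc, Finset.mem_singleton] at hγ₁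
    rw [hγ₁, one_le_sdeg_iff]
    exact ⟨i, Finset.mem_filter.mpr ⟨Finset.mem_univ _, hiI⟩, Finsupp.mem_support_iff.mp hi⟩
  · unfold coordIdeal
    rw [Ideal.span_le]
    rintro _ ⟨i, hi, rfl⟩
    exact (Finset.mem_filter.mp (Finset.mem_coe.mp hi)).2

end Stable

end RouteK

end PolyhedraGame

end Summit.ResolutionOfSingularities.ResolutionOfSingularities.Theorems

end
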